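import Summits.QuantumFields.YangMills.Theorems.UnitScaleTiltProp7ClosedFibreMinimiser
import Summits.QuantumFields.YangMills.Theorems.UnitScaleTiltProp7CritEL
import HarnessLib

/-!
# Route `UnitScaleTilt`, crux K1 child «MinimiserStabilityRegPr» (stmt-QuantumFields-19200), skeleton v10, stub `stub_existenceMinimalOrbit` (EX) —
# **THE DENSITY ROAD FOR THE REDUCIBLE-`V` SECTOR: existence of a minimiser over print's regular fibre of EVERY datum `V` from (i) existence WITH A
# RADIUS GAP («MIN-MACRO») on a DENSE SECTOR of data (the irreducible coarse fields, where the lift row `hLift` of the (α) chain holds at every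
# regular centre), (ii) local surjectivity of the descent at printed-regular points, (iii) compactness of `SU(2)^{bonds}` and continuity of
# the descent on the closed regular class — a limit argument, no symmetric centre, no abelian lift, no new constant**

Cell `ym3-torus`, width seat `ym3-torus-px10` (gen 3).  THEOREMS ONLY (0 `def`, 0 `sorry`).  `--supports stmt-QuantumFields-19200 --as helper`,
count-neutral.  YM₃ on T³ is a ladder rung (R3), not the Clay problem; nothing here claims the stub, the crux, d = 4 or the mass gap.

WHY.  ★★OWNER RULING g28-№7 located defect №7 of the EX display: the row `hSplit′` needs the lift property `hLift U₀` of the chart centre, which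
FAILS generically over REDUCIBLE coarse fields `V` (★w5-20520 g7 memos #49∕#51), and HOLDS at every regular point of the fibre over an
IRREDUCIBLE `V` (✓`Prop7NestedMeanParallelLift.hLift_of_onlyScalarParallel`).  The cure of record (ii-a) builds a symmetric regular centre
(SYM-CENTRE line, px20 LOCATE #56: an abelian smooth exact lift for the `p = 1` stratum, flux sectors by hand).  THIS FILE is the located
ALTERNATIVE that needs none of that: the route-(α) spine proves, at irreducible data, minimality over `(6)(ρ)` for every `ρ` up to an
ABSOLUTE `ρ₀` (★`Prop7ClosedFibreInteriorOfRouteAlpha.isMinOn_macro_of_Cmin_cov`, «MIN-MACRO»), irreducible coarse fields are DENSE, the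
descent is LOCALLY ONTO at printed-regular points (the (47) chart exists at every regular centre — no lift needed for it), and
`SU(2)^{bonds}` is compact: so minimisers over nearby irreducible data accumulate at a point of the fibre of `V` which lies in the CLOSED
class at the small radius — hence in print's OPEN class at twice the radius — and beats every competitor of the open class at twice the
radius (each competitor is approximated inside nearby fibres by local surjectivity and lies in the macroscopic class where the approximants'
minimality applies).  The strict∕closed conflict that kills every naive limit argument on the OPEN space (6) is paid by MIN-MACRO's radius
gap, not by Prop. 8 — no dependence on `stub_halvingStep`.

WHAT IS PROVED (sorry-free, no definition; ns `…Theorems.Prop7ExistenceByDensityLimit`):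
* §1 ★★ `exists_isMinOn_of_dense_sector` — the ABSTRACT limit lemma (pure topology): `π : X → Y`, `A : X → ℝ` continuous, classes
  `O₁ ⊆ C₁ ⊆ O₂ ⊆ Oρ` (`C₁` compact, `Oρ` open, `π` continuous at the points of `C₁`), a background class `O₀` (open), an open condition
  `P ∋ V` on data and a sector `D` with `V ∈ closure D`; IF (MACRO) every datum of `D ∩ P` carrying a background in `O₀` has a point of
  `O₁` in its fibre minimising `A` over the fibre's `Oρ`-part, and (LS) `π` maps neighbourhoods of every point of `R ⊇ O₀ ∪ O₂` in the fibre
  of `V` onto neighbourhoods of `V`, THEN every `V` carrying a background `U₀ ∈ O₀` has a point of `O₂` in its fibre minimising `A` over the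
  fibre's `O₂`-part.  (Cluster point of the chosen minimisers along `𝓝[good data] V`; `IsCompact` is literally «every filter on the set
  clusters»; limits are unique in the Hausdorff `Y`; the sublevel sets of `A` are closed.)
* §2 ★★ `exists_isMinOn_regFibrePr_of_sector` — §1 AT THE T³ LETTERS (member `F`, `h : n ≤ K`): `X = SU(2)^{bonds}` of the `K`-th
  approximation, `Y` = the same for the `n`-th, `π = descendTo F ℰp n K h` (the (0.4) descent), `A = wilsonAction4`, `O_r = 𝔘_k(r)`
  (`RegPr`, open ✓`Prop7CritEL.isOpen_regPr`), `C₁ =` the closed two-clause class at `r₁` (closed ✓`MinimiserPin.isClosed_plaqLe`∕`isClosed_divLe`,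
  compact ✓`N07DirectMethod.isCompact_of_isClosed_cfg`, inside `𝔘_k(r₂)` for `r₁ < r₂`, descent continuous at its points for `r₁ ≤ r`
  admissible ✓`MinimiserPin.continuousAt_descendTo_of_plaqLe`), `P = PlaqSmall ε₁` (open): MACRO on a sector `D` at radii
  `(r₀; r₁ < r₂ ≤ ρ)` + `V ∈ closure D` + LS at `𝔘_k(ρ)`-points of `𝔅_k(V)` ⇒ `∃ U ∈ regFibrePr r₂ V` minimising over `regFibrePr r₂ V`.
* §3 ★★★ `existenceMinimalOrbit_of_macroSector_dense_localSurj` — the `stub_existenceMinimalOrbit` BODY at `(L, B₃)` (the conclusion of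
  ✓`Prop7ExistRouteAlphaMinGCtr.existenceMinimalOrbit_of_CminG_covCtr`, VERBATIM) from THREE displayed inputs: (MACRO-SECTOR) the MIN-MACRO
  conclusion shape of ★`isMinOn_macro_of_Cmin_cov` restricted to an OPAQUE member-indexed sector `Sec i V` of data; (DENSE) every datum is in
  the closure of the sector; (LS) local surjectivity of the descent at `𝔘_k(ρ)`-points, `ρ ≤ aR`.  Constants: `O₁ ↦ 2·O₁`,
  `a₁′ ↦ min {a₁′, ρ₀∕(2O₁L³B₃), aR∕(2O₁L³B₃), r_adm∕(2O₁L³B₃)}` (`r_adm` = ✓`Prop7ClosedFibreMinimiser.exists_admissibleRadius`).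
SUPPLIERS (located, not typed here): MACRO-SECTOR at `Sec := «every V-parallel M₂(ℂ)-section is scalar»` = the sed-twin of ★`isMinOn_macro_of_Cmin_cov`
on the `…GCtr` spine with `hS` inhabited by the stub's own `U₀` (✓p671081); DENSE = two plaquette holonomies at one site made non-commuting by an
arbitrarily small change of two bonds (`sitesPerDir ≥ 6`); LS = ✓`chart47sym_of_regPr` at `A′ := H·w` + the (48) identity + ✓`ChartRealityTwS`.

HONEST SCOPE.  Topology and bookkeeping over the tree's own objects; MACRO-SECTOR, DENSE and LS are HYPOTHESES here; nothing of
[Balaban1985Variational] is asserted; no stub ∕ crux statement is advanced; YM₃ on T³ = rung R3 — not d = 4, not infinite volume, not a mass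
gap, not Clay.

References: T. Bałaban, CMP 102 (1985) 277–309 [Balaban1985Variational] ((2)–(8) pp.278–279, (14) p.280, Prop. 7 p.299); CMP 98 (1985) 17–51
[Balaban1985Averaging] ((53) p.26, Prop. 2 p.26).
-/

set_option autoImplicit false

noncomputable section

open Set Filter Topology
open scoped Matrix.Norms.L2Operator

namespace Summit.QuantumFields.YangMills.Theorems.Prop7ExistenceByDensityLimit

/-! ## §1 ★★ The abstract limit lemma -/

section Abstract

variable {X Y : Type*} [TopologicalSpace X] [TopologicalSpace Y] [T2Space Y]

/-- ★★ **EXISTENCE OF A MINIMISER BY DENSITY AND A RADIUS GAP (abstract).**  Data: `π : X → Y` (the descent), `A : X → ℝ` continuous (the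
action); classes `O₁ ⊆ C₁ ⊆ O₂ ⊆ Oρ ⊆ R`, `O₀ ⊆ R` with `O₀`, `Oρ` open, `C₁` compact and `π` continuous at every point of `C₁`; an open
condition `P` on data and a sector `D` of data with `V ∈ P ∩ closure D`.  Hypotheses: (MACRO) for every `V′ ∈ D ∩ P` with a background
`U₀′ ∈ O₀ ∩ π⁻¹{V′}` there is `U ∈ O₁ ∩ π⁻¹{V′}` with `A U ≤ A U′` for all `U′ ∈ Oρ ∩ π⁻¹{V′}`; (LS) for every `U′ ∈ R ∩ π⁻¹{V}` and every
neighbourhood `N` of `U′`, eventually along `𝓝 V` the datum `V′` has a point of `N` in its fibre.  Conclusion: a background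
`U₀ ∈ O₀ ∩ π⁻¹{V}` yields `U ∈ O₂ ∩ π⁻¹{V}` with `A U ≤ A U′` for all `U′ ∈ O₂ ∩ π⁻¹{V}`.
Proof: `V` is in the closure of the GOOD data (those carrying a MACRO-minimiser), by LS at `U₀`; choose a minimiser `u V′ ∈ O₁` per good datum;
the filter `map u (𝓝[good] V)` lives on the compact `C₁`, so it clusters at some `U* ∈ C₁ ⊆ O₂`; `π U* = V` by continuity of `π` at `U*`
and uniqueness of limits; for a competitor `U′ ∈ O₂`, LS at `U′` with the open neighbourhood `{A < A U′ + ε} ∩ Oρ` shows `A ∘ u < A U′ + ε`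
eventually, so the cluster point lies in the closed sublevel set `{A ≤ A U′ + ε}`. [cite: Balaban1985Variational, Prop. 7 p.299 (bookkeeping)] -/
theorem exists_isMinOn_of_dense_sector (π : X → Y) (A : X → ℝ) (hA : Continuous A)
    {O₀ O₁ C₁ O₂ Oρ R : Set X} (hO₀ : IsOpen O₀) (hC₁ : IsCompact C₁) (h₁ : O₁ ⊆ C₁) (h₂ : C₁ ⊆ O₂) (h₃ : O₂ ⊆ Oρ)
    (hOρ : IsOpen Oρ) (hR₀ : O₀ ⊆ R) (hR₂ : O₂ ⊆ R) (hπ : ∀ x ∈ C₁, ContinuousAt π x)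
    {P D : Set Y} (hP : IsOpen P) {V : Y} (hVP : V ∈ P) (hVD : V ∈ closure D)
    (hmacro : ∀ V' ∈ D, V' ∈ P → ∀ U₀' ∈ O₀, π U₀' = V' → ∃ U ∈ O₁, π U = V' ∧ ∀ U' ∈ Oρ, π U' = V' → A U ≤ A U')
    (hLS : ∀ U' ∈ R, π U' = V → ∀ N ∈ 𝓝 U', ∀ᶠ V' in 𝓝 V, ∃ U'' ∈ N, π U'' = V')
    {U₀ : X} (hU₀ : U₀ ∈ O₀) (hU₀V : π U₀ = V) :
    ∃ U ∈ O₂, π U = V ∧ ∀ U' ∈ O₂, π U' = V → A U ≤ A U' := by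
  classical
  -- the GOOD data: those carrying a MACRO-minimiser
  set G : Set Y := {V' | ∃ U ∈ O₁, π U = V' ∧ ∀ U' ∈ Oρ, π U' = V' → A U ≤ A U'} with hG_def
  -- Step 1: `V ∈ closure G` (density of the sector + LS at the background + openness of `P`)
  have hVG : V ∈ closure G := by
    rw [mem_closure_iff_nhds]
    intro W hW
    have hE : ∀ᶠ V' in 𝓝 V, ∃ U'' ∈ O₀, π U'' = V' := hLS U₀ (hR₀ hU₀) hU₀V O₀ (hO₀.mem_nhds hU₀)
    have hmem : W ∩ P ∩ {V' | ∃ U'' ∈ O₀, π U'' = V'} ∈ 𝓝 V := inter_mem (inter_mem hW (hP.mem_nhds hVP)) hE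
    obtain ⟨V', ⟨⟨hV'W, hV'P⟩, U₀', hU₀', hU₀'V'⟩, hV'D⟩ := mem_closure_iff_nhds.mp hVD _ hmem
    obtain ⟨U, hUO₁, hUV', hUmin⟩ := hmacro V' hV'D hV'P U₀' hU₀' hU₀'V'
    exact ⟨V', hV'W, U, hUO₁, hUV', hUmin⟩
  -- Step 2: a choice of MACRO-minimiser per good datum
  let u : Y → X := fun V' => if hV' : V' ∈ G then hV'.choose else U₀
  have hu : ∀ V' ∈ G, u V' ∈ O₁ ∧ π (u V') = V' ∧ ∀ U' ∈ Oρ, π U' = V' → A (u V') ≤ A U' := by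
    intro V' hV'
    have h := hV'.choose_spec
    simp only [u, dif_pos hV']
    exact ⟨h.1, h.2.1, h.2.2⟩
  -- Step 3: the filter of good data near `V` and its image on the compact `C₁`
  set 𝓕 : Filter Y := 𝓝[G] V with h𝓕_def
  haveI : NeBot 𝓕 := mem_closure_iff_nhdsWithin_neBot.mp hVG
  have hGev : ∀ᶠ V' in 𝓕, V' ∈ G := eventually_mem_nhdsWithin
  have hle : map u 𝓕 ≤ 𝓟 C₁ := by
    rw [le_principal_iff, mem_map]
    exact hGev.mono fun V' hV' => h₁ (hu V' hV').1
  obtain ⟨Ustar, hUC, hclust⟩ := hC₁ hle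
  -- Step 4: `π U* = V`
  have hπu : Tendsto π (map u 𝓕) (𝓝 V) := by
    rw [tendsto_map'_iff]
    have hid : Tendsto (fun V' : Y => V') 𝓕 (𝓝 V) := tendsto_id'.2 nhdsWithin_le_nhds
    refine hid.congr' ?_
    exact hGev.mono fun V' hV' => ((hu V' hV').2.1).symm
  have hπV : π Ustar = V := by
    haveI : NeBot (𝓝 Ustar ⊓ map u 𝓕) := hclust
    have h1 : Tendsto π (𝓝 Ustar ⊓ map u 𝓕) (𝓝 (π Ustar)) := (hπ Ustar hUC).tendsto.mono_left inf_le_left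
    have h2 : Tendsto π (𝓝 Ustar ⊓ map u 𝓕) (𝓝 V) := hπu.mono_left inf_le_right
    exact tendsto_nhds_unique h1 h2
  -- Step 5: minimality against every competitor of the open class at the doubled radius
  refine ⟨Ustar, h₂ hUC, hπV, fun U' hU'O₂ hU'V => ?_⟩
  refine le_of_forall_pos_le_add fun ε hε => ?_
  have hN : {x | A x < A U' + ε} ∩ Oρ ∈ 𝓝 U' :=
    inter_mem ((isOpen_lt hA continuous_const).mem_nhds (by simp [hε])) (hOρ.mem_nhds (h₃ hU'O₂))
  have hE' : ∀ᶠ V' in 𝓕, ∃ U'' ∈ {x | A x < A U' + ε} ∩ Oρ, π U'' = V' :=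
    nhdsWithin_le_nhds (hLS U' (hR₂ hU'O₂) hU'V _ hN)
  have hAev : ∀ᶠ V' in 𝓕, A (u V') ≤ A U' + ε := by
    filter_upwards [hGev, hE'] with V' hV' hV''
    obtain ⟨U'', ⟨hA'', hU''ρ⟩, hU''V'⟩ := hV''
    exact ((hu V' hV').2.2 U'' hU''ρ hU''V').trans (le_of_lt hA'')
  have hSmem : {x | A x ≤ A U' + ε} ∈ map u 𝓕 := by
    rw [mem_map]
    exact hAev
  have hclosed : IsClosed {x | A x ≤ A U' + ε} := isClosed_le hA continuous_const
  have hmem : Ustar ∈ closure {x | A x ≤ A U' + ε} := by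
    rw [mem_closure_iff_clusterPt]
    exact hclust.mono (le_principal_iff.mpr hSmem)
  rw [hclosed.closure_eq] at hmem
  exact hmem

end Abstract

/-! ## §2 ★★ The limit lemma at the T³ letters (member level) -/

section Member

open Literature.MathematicalPhysics.QuantumFieldTheory.Balaban1983to89
open Literature.MathematicalPhysics.QuantumFieldTheory.Balaban1983to89.T3ContinuumYM3Torus
open Literature.MathematicalPhysics.QuantumFieldTheory.Balaban1983to89.T3UnitLawDensityEML (ℰp)
open Literature.MathematicalPhysics.QuantumFieldTheory.Balaban1983to89.T3PrintedRegularMinimiser (RegPr DivSmall regFibrePr mem_regFibrePr_iff)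
open Literature.MathematicalPhysics.QuantumFieldTheory.Balaban1983to89.T3PrintedMinimiserExistence (regThreshold_mono regPr_mono)
open Literature.MathematicalPhysics.QuantumFieldTheory.Balaban1983to89.T3RegularMinimiser (regThreshold)
open Literature.MathematicalPhysics.QuantumFieldTheory.Balaban1983to89.T3ConstrainedMinimiser (fibre)
open Literature.MathematicalPhysics.QuantumFieldTheory.Balaban1983to89.T3TiltDescent (descendTo)
open Literature.MathematicalPhysics.QuantumFieldTheory.Balaban1983to89.B10Eq27TorusAxialLog (toUField unitsField)
open Literature.MathematicalPhysics.QuantumFieldTheory.Balaban1983to89.B10Eq68TorusRegularity (covDivT)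
open Literature.MathematicalPhysics.QuantumFieldTheory.Balaban1983to89.ExpMeanLog (deltaSU deltaSU_pos)
open Summit.QuantumFields.YangMills.BalabanUVNodes.N07DirectMethod (continuous_wilsonAction4 isCompact_of_isClosed_cfg continuous_dist1_plaqHol)
open Summit.QuantumFields.YangMills.Theorems.MinimiserPin (isClosed_plaqLe isClosed_divLe regThreshold_eq continuousAt_descendTo_of_plaqLe)
open Summit.QuantumFields.YangMills.Theorems.Prop7CritEL (isOpen_regPr)
open Summit.QuantumFields.YangMills.Theorems.Prop7ClosedFibreMinimiser (exists_admissibleRadius)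

variable (F : T3Family) {n K : ℕ} (h : n ≤ K)

/-- **`PlaqSmall ε` IS AN OPEN CONDITION on `SU(2)^{bonds}`** (finitely many strict inequalities of continuous functions).
[cite: Balaban1985Variational, (7) p.278 (bookkeeping)] -/
theorem isOpen_plaqSmall (j : ℕ) (ε : ℝ) :
    IsOpen {V : GaugeField (F.P j) 0 (Matrix.specialUnitaryGroup (Fin 2) ℂ) | PlaqSmall ε V} := by
  have hOeq : {V : GaugeField (F.P j) 0 (Matrix.specialUnitaryGroup (Fin 2) ℂ) | PlaqSmall ε V} =
      ⋂ p : Plaq (F.P j) 0, {V | GaugeGroup.dist1 (GaugeField.plaqHol V p) < ε} := by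
    ext V
    simp only [Set.mem_setOf_eq, Set.mem_iInter, PlaqSmall]
  rw [hOeq]
  exact isOpen_iInter_of_finite fun p => isOpen_lt (continuous_dist1_plaqHol (N := 2) p) continuous_const

/-- **THE CLOSED TWO-CLAUSE CLASS AT `r₁` LIES IN `𝔘_k(r₂)` FOR `r₁ < r₂`** (both thresholds are strictly monotone in the radius).
[cite: Balaban1985Variational, (2) p.278 (bookkeeping)] -/
theorem regPr_of_closedClass {r₁ r₂ : ℝ} (hr : r₁ < r₂) {U : GaugeField (F.P K) 0 (Matrix.specialUnitaryGroup (Fin 2) ℂ)}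
    (hplaq : ∀ p : Plaq (F.P K) 0, GaugeGroup.dist1 (GaugeField.plaqHol U p) ≤ regThreshold F n K r₁)
    (hdiv : ∀ b : PBond (F.P K) 0, ‖covDivT 1 (unitsField (toUField U)) b.dir b.src‖ ≤ r₁ * ((F.L : ℝ)⁻¹) ^ (3 * (K - n))) :
    RegPr F n K r₂ U := by
  have hLpos : (0 : ℝ) < F.L := by
    have := F.hL.2
    exact_mod_cast (by omega : 0 < F.L)
  have hthr : regThreshold F n K r₁ < regThreshold F n K r₂ := by
    rw [regThreshold_eq, regThreshold_eq]
    have : 0 < ((((F.P K).L : ℝ) ^ (K - n))⁻¹) ^ 2 := by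
      have := (F.P K).L_pos
      positivity
    exact mul_lt_mul_of_pos_right hr this
  have hLpow : 0 < ((F.L : ℝ)⁻¹) ^ (3 * (K - n)) := by positivity
  exact ⟨fun p => (hplaq p).trans_lt hthr, fun b => (hdiv b).trans_lt (mul_lt_mul_of_pos_right hr hLpow)⟩

/-- ★★ **THE LIMIT LEMMA AT THE T³ LETTERS (member level).**  Radii `0 < r₀`, `r₁ < r₂ ≤ ρ`, `r₀ ≤ ρ`, `r₁ ≤ r` with `2r` admissible
([Balaban1985Averaging] (53): `C₀(3)·2r ≤ ⅓`, `4r ≤ 2δ₂∕(7L)²`); a sector `D` of data and a (7)-datum `V` (`PlaqSmall ε₁`) in its closure;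
(MACRO on `D`) every `V′ ∈ D` with `PlaqSmall ε₁ V′` and a background `U₀′ ∈ 𝔘_k(r₀) ∩ 𝔅_k(V′)` carries `U ∈ (6)(r₁)(V′)` minimising the Wilson
action over `(6)(ρ)(V′)`; (LS) at every `U′ ∈ 𝔘_k(ρ) ∩ 𝔅_k(V)` the descent maps neighbourhoods of `U′` onto neighbourhoods of `V`.  THEN every
background `U₀ ∈ 𝔘_k(r₀) ∩ 𝔅_k(V)` yields `U ∈ (6)(r₂)(V)` minimising the Wilson action over `(6)(r₂)(V)` — §1 with `X = SU(2)^{bonds}`,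
`π = D_{n,K}`, `C₁` the closed two-clause class at `r₁` (compact; descent continuous at its points). [cite: Balaban1985Variational, (2)-(6) p.278, Prop. 7 p.299; Balaban1985Averaging, (53) p.26] -/
theorem exists_isMinOn_regFibrePr_of_sector {r : ℝ} (hr : 0 < r)
    (hr3 : (143 * ((((3 + 4 : ℕ) : ℝ)) ^ 2 / 4) ^ 2) * (2 * r) ≤ 1 / 3)
    (hr2 : 2 * (2 * r) ≤ 2 * deltaSU (Fin 2) / (((3 + 4) * F.L : ℕ) : ℝ) ^ 2)
    {r₀ r₁ r₂ ρ ε₁ : ℝ} (hr₁r : r₁ ≤ r) (hr₁₂ : r₁ < r₂) (hr₂ρ : r₂ ≤ ρ) (hr₀ρ : r₀ ≤ ρ)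
    (D : Set (GaugeField (F.P n) 0 (Matrix.specialUnitaryGroup (Fin 2) ℂ)))
    (hmacro : ∀ V' ∈ D, PlaqSmall ε₁ V' → ∀ U₀' : GaugeField (F.P K) 0 (Matrix.specialUnitaryGroup (Fin 2) ℂ),
      RegPr F n K r₀ U₀' → U₀' ∈ fibre F ℰp n K h V' →
        ∃ U ∈ regFibrePr F n K h r₁ V', IsMinOn (fun W : GaugeField (F.P K) 0 (Matrix.specialUnitaryGroup (Fin 2) ℂ) => wilsonAction4 W)
          (regFibrePr F n K h ρ V') U)
    {V : GaugeField (F.P n) 0 (Matrix.specialUnitaryGroup (Fin 2) ℂ)} (hV : PlaqSmall ε₁ V) (hVD : V ∈ closure D)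
    (hLS : ∀ U' : GaugeField (F.P K) 0 (Matrix.specialUnitaryGroup (Fin 2) ℂ), RegPr F n K ρ U' → U' ∈ fibre F ℰp n K h V →
      ∀ N ∈ 𝓝 U', ∀ᶠ V' in 𝓝 V, ∃ U'' ∈ N, U'' ∈ fibre F ℰp n K h V')
    {U₀ : GaugeField (F.P K) 0 (Matrix.specialUnitaryGroup (Fin 2) ℂ)} (hU₀ : RegPr F n K r₀ U₀) (hU₀V : U₀ ∈ fibre F ℰp n K h V) :
    ∃ U ∈ regFibrePr F n K h r₂ V, IsMinOn (fun W : GaugeField (F.P K) 0 (Matrix.specialUnitaryGroup (Fin 2) ℂ) => wilsonAction4 W)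
      (regFibrePr F n K h r₂ V) U := by
  haveI : T2Space (GaugeField (F.P n) 0 (Matrix.specialUnitaryGroup (Fin 2) ℂ)) :=
    inferInstanceAs (T2Space (PBond (F.P n) 0 → Matrix.specialUnitaryGroup (Fin 2) ℂ))
  -- the classes
  set C₁ : Set (GaugeField (F.P K) 0 (Matrix.specialUnitaryGroup (Fin 2) ℂ)) :=
    {U | ∀ p : Plaq (F.P K) 0, GaugeGroup.dist1 (GaugeField.plaqHol U p) ≤ regThreshold F n K r₁} ∩
      {U | ∀ b : PBond (F.P K) 0, ‖covDivT 1 (unitsField (toUField U)) b.dir b.src‖ ≤ r₁ * ((F.L : ℝ)⁻¹) ^ (3 * (K - n))} with hC₁_def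
  have hC₁closed : IsClosed C₁ := (isClosed_plaqLe F K _).inter (isClosed_divLe F K _)
  have hC₁cpt : IsCompact C₁ := isCompact_of_isClosed_cfg (N := 2) hC₁closed
  have h₁ : {U : GaugeField (F.P K) 0 (Matrix.specialUnitaryGroup (Fin 2) ℂ) | RegPr F n K r₁ U} ⊆ C₁ :=
    fun U hU => ⟨fun p => (hU.1 p).le, fun b => (hU.2 b).le⟩
  have h₂ : C₁ ⊆ {U : GaugeField (F.P K) 0 (Matrix.specialUnitaryGroup (Fin 2) ℂ) | RegPr F n K r₂ U} :=
    fun U hU => regPr_of_closedClass F hr₁₂ hU.1 hU.2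
  have h₃ : {U : GaugeField (F.P K) 0 (Matrix.specialUnitaryGroup (Fin 2) ℂ) | RegPr F n K r₂ U} ⊆ {U | RegPr F n K ρ U} :=
    fun U hU => regPr_mono F hr₂ρ hU
  have hR₀ : {U : GaugeField (F.P K) 0 (Matrix.specialUnitaryGroup (Fin 2) ℂ) | RegPr F n K r₀ U} ⊆ {U | RegPr F n K ρ U} :=
    fun U hU => regPr_mono F hr₀ρ hU
  have hπ : ∀ x ∈ C₁, ContinuousAt (descendTo F ℰp n K h) x :=
    fun x hx => continuousAt_descendTo_of_plaqLe F n K h hr hr3 hr2 (regThreshold_mono F hr₁r) hx.1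
  -- MACRO and LS in the abstract currency (`U ∈ fibre V ↔ descendTo U = V` is definitional)
  have hmacro' : ∀ V' ∈ D, V' ∈ {W : GaugeField (F.P n) 0 (Matrix.specialUnitaryGroup (Fin 2) ℂ) | PlaqSmall ε₁ W} →
      ∀ U₀' ∈ {U : GaugeField (F.P K) 0 (Matrix.specialUnitaryGroup (Fin 2) ℂ) | RegPr F n K r₀ U}, descendTo F ℰp n K h U₀' = V' →
        ∃ U ∈ {U : GaugeField (F.P K) 0 (Matrix.specialUnitaryGroup (Fin 2) ℂ) | RegPr F n K r₁ U}, descendTo F ℰp n K h U = V' ∧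
          ∀ U' ∈ {U : GaugeField (F.P K) 0 (Matrix.specialUnitaryGroup (Fin 2) ℂ) | RegPr F n K ρ U}, descendTo F ℰp n K h U' = V' →
            wilsonAction4 U ≤ wilsonAction4 U' := by
    intro V' hV'D hV'P U₀' hU₀' hU₀'V'
    obtain ⟨U, hU, hUmin⟩ := hmacro V' hV'D hV'P U₀' hU₀' hU₀'V'
    rw [mem_regFibrePr_iff] at hU
    refine ⟨U, hU.2, hU.1, fun U' hU' hU'V' => hUmin ?_⟩
    exact (mem_regFibrePr_iff F).2 ⟨hU'V', hU'⟩
  have hLS' : ∀ U' ∈ {U : GaugeField (F.P K) 0 (Matrix.specialUnitaryGroup (Fin 2) ℂ) | RegPr F n K ρ U}, descendTo F ℰp n K h U' = V →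
      ∀ N ∈ 𝓝 U', ∀ᶠ V' in 𝓝 V, ∃ U'' ∈ N, descendTo F ℰp n K h U'' = V' :=
    fun U' hU' hU'V N hN => hLS U' hU' hU'V N hN
  obtain ⟨U, hUO₂, hUV, hUmin⟩ := exists_isMinOn_of_dense_sector (descendTo F ℰp n K h) (fun W => wilsonAction4 W)
    (continuous_wilsonAction4 (N := 2)) (isOpen_regPr F n K r₀) hC₁cpt h₁ h₂ h₃ (isOpen_regPr F n K ρ) hR₀ h₃ hπ
    (isOpen_plaqSmall F n ε₁) hV hVD hmacro' hLS' hU₀ hU₀V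
  refine ⟨U, (mem_regFibrePr_iff F).2 ⟨hUV, hUO₂⟩, fun U' hU' => ?_⟩
  rw [mem_regFibrePr_iff] at hU'
  exact hUmin U' hU'.2 hU'.1

end Member

/-! ## §3 ★★★ The `stub_existenceMinimalOrbit` body at `(L, B₃)` from MACRO-SECTOR ∧ DENSE ∧ LS -/

section Uniform

open Literature.MathematicalPhysics.QuantumFieldTheory.Balaban1983to89
open Literature.MathematicalPhysics.QuantumFieldTheory.Balaban1983to89.T3ContinuumYM3Torus
open Literature.MathematicalPhysics.QuantumFieldTheory.Balaban1983to89.T3UnitLawDensityEML (ℰp)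
open Literature.MathematicalPhysics.QuantumFieldTheory.Balaban1983to89.T3PrintedRegularMinimiser (RegPr DivSmall regFibrePr mem_regFibrePr_iff)
open Literature.MathematicalPhysics.QuantumFieldTheory.Balaban1983to89.T3ConstrainedMinimiser (fibre)
open Literature.MathematicalPhysics.QuantumFieldTheory.Balaban1983to89.T3TiltDescent (descendTo)
open Literature.MathematicalPhysics.QuantumFieldTheory.Balaban1983to89.ExpMeanLog (deltaSU deltaSU_pos)

variable {L : ℕ}

/-- ★★★ **EX ON THE DENSITY ROAD — the `stub_existenceMinimalOrbit` body at `(L, B₃)` (= the conclusion of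
✓`Prop7ExistRouteAlphaMinGCtr.existenceMinimalOrbit_of_CminG_covCtr`, VERBATIM) from three displayed inputs**:
(MACRO-SECTOR) the MIN-MACRO conclusion shape of ★`Prop7ClosedFibreInteriorOfRouteAlpha.isMinOn_macro_of_Cmin_cov` for the data of an OPAQUE sector `Sec F n`
(its supplier: the route-(α) chain at irreducible data, where the lift row holds at every regular centre, ✓p671081); (DENSE) every datum lies in the closure
of the sector; (LS) the descent is locally onto at every point of `𝔘_k(ρ)`, `ρ ≤ aR` (its supplier: the (47) chart at a regular centre).  Constants: `O₁ ↦ 2O₁`,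
`a₁′ ↦ min {a₁′, ρ∕(2O₁L³B₃), r∕(O₁L³B₃)}` with `ρ = min ρ₀ aR` and `r` the admissible radius of [Balaban1985Averaging] (53) at block size `L`; member by member
§2 `exists_isMinOn_regFibrePr_of_sector` at radii `(L³B₃ε₁; O₁L³B₃ε₁ < 2O₁L³B₃ε₁ ≤ ρ)`. [cite: Balaban1985Variational, Prop. 7 p.299, (14) p.280, (2)-(6) p.278; Balaban1985Averaging, (53) p.26] -/
theorem existenceMinimalOrbit_of_macroSector_dense_localSurj (hL : 1 < L) {B₃ : ℝ} (hB₃ : 4 < B₃)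
    (Sec : ∀ (F : T3Family) (n : ℕ), GaugeField (F.P n) 0 (Matrix.specialUnitaryGroup (Fin 2) ℂ) → Prop)
    (hmacro : ∃ ρ₀ a₁' O₁ : ℝ, 0 < ρ₀ ∧ 0 < a₁' ∧ 1 ≤ O₁ ∧
      ∀ (F : T3Family), F.L = L → ∀ (n K : ℕ) (hnK : n < K) (ε₁ : ℝ), 0 < ε₁ →
        ∀ V : GaugeField (F.P n) 0 (Matrix.specialUnitaryGroup (Fin 2) ℂ), Sec F n V → PlaqSmall ε₁ V →
          ∀ U₀ : GaugeField (F.P K) 0 (Matrix.specialUnitaryGroup (Fin 2) ℂ), RegPr F n K ((L : ℝ) ^ 3 * B₃ * ε₁) U₀ → U₀ ∈ fibre F ℰp n K hnK.le V →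
            ε₁ ≤ a₁' → O₁ * (L : ℝ) ^ 3 * B₃ * ε₁ ≤ ρ₀ ∧
              ∃ W ∈ regFibrePr F n K hnK.le (O₁ * (L : ℝ) ^ 3 * B₃ * ε₁) V, ∀ ρ : ℝ, O₁ * (L : ℝ) ^ 3 * B₃ * ε₁ ≤ ρ → ρ ≤ ρ₀ →
                IsMinOn (fun W' : GaugeField (F.P K) 0 (Matrix.specialUnitaryGroup (Fin 2) ℂ) => wilsonAction4 W') (regFibrePr F n K hnK.le ρ V) W)
    (hdense : ∀ (F : T3Family), F.L = L → ∀ (n : ℕ) (V : GaugeField (F.P n) 0 (Matrix.specialUnitaryGroup (Fin 2) ℂ)), V ∈ closure {V' | Sec F n V'})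
    (hLS : ∃ aR : ℝ, 0 < aR ∧ ∀ (F : T3Family), F.L = L → ∀ (n K : ℕ) (hnK : n < K) (ρ : ℝ), ρ ≤ aR →
      ∀ U' : GaugeField (F.P K) 0 (Matrix.specialUnitaryGroup (Fin 2) ℂ), RegPr F n K ρ U' →
        ∀ N ∈ 𝓝 U', ∀ᶠ V' in 𝓝 (descendTo F ℰp n K hnK.le U'), ∃ U'' ∈ N, U'' ∈ fibre F ℰp n K hnK.le V') :
    ∃ a₁' O₁ : ℝ, 0 < a₁' ∧ 1 ≤ O₁ ∧
    ∀ (F : T3Family), F.L = L → ∀ (n K : ℕ) (hnK : n < K) (ε₁ : ℝ), 0 < ε₁ →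
      ∀ V : GaugeField (F.P n) 0 (Matrix.specialUnitaryGroup (Fin 2) ℂ), PlaqSmall ε₁ V →
        ∀ U₀ : GaugeField (F.P K) 0 (Matrix.specialUnitaryGroup (Fin 2) ℂ), RegPr F n K ((L : ℝ) ^ 3 * B₃ * ε₁) U₀ → U₀ ∈ fibre F ℰp n K hnK.le V →
          ε₁ ≤ a₁' → ∃ U ∈ regFibrePr F n K hnK.le (O₁ * (L : ℝ) ^ 3 * B₃ * ε₁) V,
            IsMinOn (fun W : GaugeField (F.P K) 0 (Matrix.specialUnitaryGroup (Fin 2) ℂ) => wilsonAction4 W)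
              (regFibrePr F n K hnK.le (O₁ * (L : ℝ) ^ 3 * B₃ * ε₁) V) U := by
  obtain ⟨ρ₀, a₁', O₁, hρ₀, ha₁', hO₁, HM⟩ := hmacro
  obtain ⟨aR, haR, HLS⟩ := hLS
  have hL0 : (0 : ℝ) < (L : ℝ) := by exact_mod_cast (lt_trans zero_lt_one hL)
  have hB₃0 : 0 < B₃ := by linarith
  have hO₁0 : 0 < O₁ := lt_of_lt_of_le one_pos hO₁
  have hK : 0 < O₁ * (L : ℝ) ^ 3 * B₃ := by positivity
  have hK2 : 0 < 2 * O₁ * (L : ℝ) ^ 3 * B₃ := by positivity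
  -- the admissible radius of [Balaban1985Averaging] (53) at block size `L` (shape of ✓`Prop7ClosedFibreMinimiser.exists_admissibleRadius`)
  set C : ℝ := 143 * ((((3 + 4 : ℕ) : ℝ)) ^ 2 / 4) ^ 2 with hC
  set M : ℝ := (((3 + 4) * L : ℕ) : ℝ) ^ 2 with hM
  have hCpos : 0 < C := by rw [hC]; positivity
  have hMpos : 0 < M := by
    rw [hM]
    have : (0 : ℝ) < (((3 + 4) * L : ℕ) : ℝ) := by push_cast; positivity
    positivity
  have hδ := deltaSU_pos (n := Fin 2)
  set r : ℝ := min (1 / (6 * C)) (deltaSU (Fin 2) / (2 * M)) with hr_def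
  have hr : 0 < r := lt_min (by positivity) (by positivity)
  have hr3 : C * (2 * r) ≤ 1 / 3 := by
    have h1 : r ≤ 1 / (6 * C) := min_le_left _ _
    calc C * (2 * r) ≤ C * (2 * (1 / (6 * C))) := by gcongr
      _ = 1 / 3 := by field_simp; ring
  have hr2 : 2 * (2 * r) ≤ 2 * deltaSU (Fin 2) / M := by
    have h2 : r ≤ deltaSU (Fin 2) / (2 * M) := min_le_right _ _
    calc 2 * (2 * r) ≤ 2 * (2 * (deltaSU (Fin 2) / (2 * M))) := by gcongr
      _ = 2 * deltaSU (Fin 2) / M := by field_simp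
  -- the working macroscopic radius and the smallness of `ε₁`
  set ρ : ℝ := min ρ₀ aR with hρ_def
  have hρ : 0 < ρ := lt_min hρ₀ haR
  set a : ℝ := min a₁' (min (ρ / (2 * O₁ * (L : ℝ) ^ 3 * B₃)) (r / (O₁ * (L : ℝ) ^ 3 * B₃))) with ha_def
  have ha : 0 < a := lt_min ha₁' (lt_min (div_pos hρ hK2) (div_pos hr hK))
  refine ⟨a, 2 * O₁, ha, by linarith, ?_⟩
  intro F hF n K hnK ε₁ hε₁ V hV U₀ hU₀ hfib hε₁a
  have hε₁a₁ : ε₁ ≤ a₁' := hε₁a.trans (min_le_left _ _)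
  have hε₁ρ : 2 * O₁ * (L : ℝ) ^ 3 * B₃ * ε₁ ≤ ρ := by
    have := hε₁a.trans ((min_le_right _ _).trans (min_le_left _ _))
    have := (le_div_iff₀ hK2).1 this
    linarith
  have hε₁r : O₁ * (L : ℝ) ^ 3 * B₃ * ε₁ ≤ r := by
    have := hε₁a.trans ((min_le_right _ _).trans (min_le_right _ _))
    have := (le_div_iff₀ hK).1 this
    linarith
  have hr₁₂ : O₁ * (L : ℝ) ^ 3 * B₃ * ε₁ < 2 * O₁ * (L : ℝ) ^ 3 * B₃ * ε₁ := by
    have : 0 < O₁ * (L : ℝ) ^ 3 * B₃ * ε₁ := by positivity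
    linarith
  have hρ₁ : O₁ * (L : ℝ) ^ 3 * B₃ * ε₁ ≤ ρ := hr₁₂.le.trans hε₁ρ
  have hr₀ρ : (L : ℝ) ^ 3 * B₃ * ε₁ ≤ ρ := by
    have h0 : (L : ℝ) ^ 3 * B₃ * ε₁ ≤ O₁ * (L : ℝ) ^ 3 * B₃ * ε₁ := by
      have : 0 ≤ (L : ℝ) ^ 3 * B₃ * ε₁ := by positivity
      nlinarith
    exact h0.trans hρ₁
  have hρρ₀ : ρ ≤ ρ₀ := min_le_left _ _
  have hρaR : ρ ≤ aR := min_le_right _ _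
  -- the admissibility conditions at the member's own block size `F.L = L`
  have hr3F : (143 * ((((3 + 4 : ℕ) : ℝ)) ^ 2 / 4) ^ 2) * (2 * r) ≤ 1 / 3 := hr3
  have hr2F : 2 * (2 * r) ≤ 2 * deltaSU (Fin 2) / (((3 + 4) * F.L : ℕ) : ℝ) ^ 2 := by rw [hF]; exact hr2
  -- MACRO on the sector and LS at the member, in §2's shape
  have hmacroF : ∀ V' ∈ {V' : GaugeField (F.P n) 0 (Matrix.specialUnitaryGroup (Fin 2) ℂ) | Sec F n V'}, PlaqSmall ε₁ V' →
      ∀ U₀' : GaugeField (F.P K) 0 (Matrix.specialUnitaryGroup (Fin 2) ℂ), RegPr F n K ((L : ℝ) ^ 3 * B₃ * ε₁) U₀' → U₀' ∈ fibre F ℰp n K hnK.le V' →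
        ∃ U ∈ regFibrePr F n K hnK.le (O₁ * (L : ℝ) ^ 3 * B₃ * ε₁) V',
          IsMinOn (fun W : GaugeField (F.P K) 0 (Matrix.specialUnitaryGroup (Fin 2) ℂ) => wilsonAction4 W) (regFibrePr F n K hnK.le ρ V') U := by
    intro V' hV' hV'P U₀' hU₀' hfib'
    obtain ⟨_, W, hW, hWmin⟩ := HM F hF n K hnK ε₁ hε₁ V' hV' hV'P U₀' hU₀' hfib' hε₁a₁
    exact ⟨W, hW, hWmin ρ hρ₁ hρρ₀⟩
  have hLSF : ∀ U' : GaugeField (F.P K) 0 (Matrix.specialUnitaryGroup (Fin 2) ℂ), RegPr F n K ρ U' → U' ∈ fibre F ℰp n K hnK.le V →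
      ∀ N ∈ 𝓝 U', ∀ᶠ V' in 𝓝 V, ∃ U'' ∈ N, U'' ∈ fibre F ℰp n K hnK.le V' := by
    intro U' hU' hU'V N hN
    have hU'V' : descendTo F ℰp n K hnK.le U' = V := hU'V
    have h := HLS F hF n K hnK ρ hρaR U' hU' N hN
    rwa [hU'V'] at h
  exact exists_isMinOn_regFibrePr_of_sector F hnK.le hr hr3F hr2F hε₁r hr₁₂ hε₁ρ hr₀ρ {V' | Sec F n V'} hmacroF hV
    (hdense F hF n V) hLSF hU₀ hfib

end Uniform

end Summit.QuantumFields.YangMills.Theorems.Prop7ExistenceByDensityLimit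

end
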